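import Summits.NavierStokesRegularity.TurbBounds.FSU1.Corner

/-!
HONEST FRAMING: rigorous bounds for the stated PDE and boundary conditions; no claim about physical turbulence beyond the bound.
(FS-U1″ finite part in Lean; producer pub-turb-sos gen 19; STAGED.)
-/

set_option linter.style.longLine false
set_option autoImplicit false

namespace Summit.NavierStokesRegularity.TurbBounds.FSU1

/-! ## 8. The parameters of record and their scalar / corner certificates -/

/-- FS-PROOF-DRAFT §3.0: `a = 129/250`, `b = 1/5`, `D = 41/10`, `ρ_I = 44627207783781/(5·10¹³)`, `u_I = 1/3`. -/
def p0 : Params := ⟨129 / 250, 1 / 5, 41 / 10, 44627207783781 / 50000000000000, 1 / 3⟩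

/-- Corner witnesses for `p0` (build_fsu1.py; re-checked by the kernel below). -/
def w0 : CRow := ⟨383121/1000000, 2235542763867/1000000000000, 128365152491/125000000000, 2077968029949/1000000000000000000000, 240619678837/1000⟩

/-- Kernel evaluation (`decide +kernel`): the corner witnesses `w0` pass `cornerCheck p0`. -/
theorem corner_check_p0 : cornerCheck p0 w0 = true := by
  decide +kernel

/-- (A_corner) for the parameters of record. -/
theorem corner_p0 : CornerIneq p0 w0.eps := cornerIneq_of_check p0 w0 corner_check_p0

/-- The scalar lines for the parameters of record (rational ones by evaluation; the three with `π` from `π² ≥ 9.8696044`, `√1000 ≥ 31.6227766`). -/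
theorem scalarLines_p0 : ScalarLines p0 := by
  have hpi := PI2LO_le
  have hP : ((PI2LO : ℚ) : ℝ) = 98696044 / 10000000 := by norm_num [PI2LO]
  rw [hP] at hpi
  have hpi0 : (0 : ℝ) ≤ Real.pi ^ 2 := sq_nonneg _
  have hR := R4LO_le_R4
  have hRv : ((R4LO : ℚ) : ℝ) = 316227766 / 10000000 := by norm_num [R4LO]
  rw [hRv] at hR
  refine ⟨by decide +kernel, by decide +kernel, by decide +kernel, by decide +kernel, by decide +kernel, by decide +kernel,
    by decide +kernel, by decide +kernel, by decide +kernel, by decide +kernel, by decide +kernel, ?_, ?_, ?_⟩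
  · simp only [p0]
    push_cast
    nlinarith [mul_nonneg (sub_nonneg.mpr hpi) hpi0, hpi]
  · have e : ((p0.bp : ℚ) : ℝ) = 33359 / 250000 := by norm_num [p0, Params.bp]
    have e2 : ((p0.kapI : ℚ) : ℝ) = 44627207783781 / 20500000000000 := by norm_num [p0, Params.kapI]
    rw [e, e2]
    simp only [p0]
    push_cast
    have : (0 : ℝ) ≤ Real.pi ^ 2 / (4 * (44627207783781 / 50000000000000 : ℝ) ^ 2) := by positivity
    nlinarith
  · have e2 : ((p0.kapI : ℚ) : ℝ) = 44627207783781 / 20500000000000 := by norm_num [p0, Params.kapI]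
    rw [e2]
    have : R4 ≥ 0 := by unfold R4; positivity
    nlinarith

end Summit.NavierStokesRegularity.TurbBounds.FSU1
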